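import Summits.Langlands.Langlands.Theses.SplitPrimeInduction
import Literature.NumberTheory.Automorphic.ScholzeTorsionGalois

/-!
# Birth skeleton (BC3) for crux stmt-Langlands-16942
`Summit.Langlands.Langlands.Theses.SplitPrimeInduction.TorsionLeviInduction` — line `birth`

Route `route-Langlands-SplitPrimeInduction` (`closes (h₁ : LanglandsOverQ) (h₂ : TorsionLeviInduction)
(h₃ : MonomialSerreAtSplitPrimes) (h₄ : DeinductionR) (hA : Assembly) : Langlands`).  The crux (rank 2,
"torsion twisted-Levi induction") says: for a number field `F`, `n ≥ 1` with (`n` even ∨ `r₁(F) ≤ 1`),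
a prime `p` completely split in `F`, a level `K = K_S · ∏_{v ∉ S} GL_n(𝒪_v)`, uniformisers `ϖ` and a
field `k` of characteristic `p`, every system `a` of Hecke eigenvalues (Scholze's `T^{(j)}_v`, `v ∉ S`)
OCCURRING in `H^i(X_K, k)` for `GL_n/F` has its INDUCED system `b` occurring in some `H^{i'}(X_{K'}, k)`
for `GL_{n[F:ℚ]}/ℚ`: `P_v(b)(X) = ∏_{w ∣ v} P_w(a)(X^{f(w|v)})` for all `v ∉ S'` (Scholze polynomials
`P(X) = 1 + ∑_j (−1)^j q^{j(j+1)/2} a_j X^j = det(1 − X·Frob^{geom})`, fibres of `S'` avoiding `S`).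

This file is the skeleton that concludes the crux BY NAME from three named stubs — the GALOIS DETOUR,
i.e. the standard conditional proof of a mod-`p` Langlands functoriality (reciprocity over the source
field, the functorial operation on the Galois side, a Serre-type modularity statement over the target
field), typed in Scholze's normalisation so that the three pieces compose by pure logic:

* `stub_torsionGaloisRep` — RECIPROCITY mod `p` OVER `F` WITH SIGNED ODDNESS (Calegari–Geraghty
  Conjecture A at trivial weight, `m = 1`, in the normalisation of Scholze's Cor. V.4.3, plus the
  Caraiani–Le Hung parity at the real places in its signed form): an occurring `a` has, over every
  algebraically closed `k' ⊇ k` (discrete), a continuous `σ : Γ_F → GL_n(k')`, unramified with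
  `det(1 − X·σ(Frob_w^{geom})) = P_w(a)` at every `w ∉ S`, `w ∤ p`, and SCHOLZE-ODD at each real place
  (`dim ker(σ(c)+1) = dim ker(σ(c)−1) + (n mod 2)` for `p` odd).  Known for `F` totally real or CM
  (Scholze 2015 + Caraiani–Le Hung 2016, conditionally on Arthur outside Rem. V.4.6); OPEN otherwise.
* `stub_oddInduction` — INDUCTION OF `k`-RATIONAL FROBENIUS DATA WITH PARITY TRANSFER (provable now,
  size L): `σ` as above induces `R : Γ_ℚ → GL_{n[F:ℚ]}(k')` unramified off a finite `T` (whose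
  complement has fibres avoiding `S` and `p`) with `det(1 − X·R(Frob_v^{geom})) = ∏_{w∣v} P_w(X^{f_w})`
  (Mackey at `v`), and — exactly when `n` is even or `r₁(F) ≤ 1` — `R` is Scholze-odd at the real place
  of `ℚ` (Mackey at `∞`: real places of `F` contribute `σ(c_w)`, complex places regular
  representations of `⟨c⟩`).  This stub is where the crux's side condition (`Even n ∨ r₁ ≤ 1`) is used.
* `stub_serreOccurrence` — SERRE-TYPE OCCURRENCE OVER `ℚ` (generalised Serre conjecture, weak form,
  arbitrary level, trivial coefficients, Scholze normalisation): a continuous Scholze-odd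
  `R : Γ_ℚ → GL_m(k')` with `k`-rational `det(1 − X·R(Frob_v^{geom})) = Q_v` off `T` is the `σ_b` of an
  eigensystem `b` occurring in some `H^{i'}(X_{K'}, k)` for `GL_m/ℚ`, `P_v(b) = Q_v` off some finite
  `S' ⊇ T`.  `m = 1`: class field theory; `m = 2`: Khare–Wintenberger (+ Eisenstein classes for the
  reducible odd `R`, all Serre weights traded for level `p` by Ash–Stevens); `m ≥ 3`: OPEN (Ash–Sinnott,
  Ash–Doud–Pollack Conj. 3.1).  The hardest stub.

Shape (for `ledger skeleton check`): §0 names the crux's clauses as `def`s (VERBATIM sub-terms of the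
route decl, or the tree's `HeckeEigenvaluesOccurGL` / `scholzeHeckePolynomial` of which the route decl
inlines the bodies — rev 3 of the route; `crux_iff` is `Iff.rfl`, which certifies it); §1 is the Galois
vocabulary (`HasScholzePolyAt` = the conclusion shape of the tree's named fact
`Scholze2015_galoisRep_of_modPEigensystem`, `IsScholzeOdd`, `IsOddAtRealPlaces`, `inducedPolynomial`);
each stub is `theorem stub_<name> (binders) : <conclusion> := by sorry`; `_Goal.stub_<name> : Prop :=
type_of% @stub_<name>` names that statement; the composition
`TorsionLeviInduction_of (hA : _Goal.stub_torsionGaloisRep) (hC : _Goal.stub_oddInduction)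
(hB : _Goal.stub_serreOccurrence) : TorsionLeviInduction` is proved without `sorry` and concludes the
route decl BY NAME; the last `example` feeds the three stubs to it.

What the skeleton does NOT do: it does not use the split prime (the Galois detour is valid for every
`p`; the route's own MECHANISM — the twisted Levi `Res_{F/ℚ}GL_n` becoming the Levi `GL_n^d` of
`GL_{nd}(ℚ_p)` at a split `p`, Emerton's `J_P` on completed cohomology, propagation along induced
eigenvariety components — is not typable today (no `J_P`, no characteristic-0 trianguline functors in
the tree; route header "NOT DECOMPOSED YET") and would, if it works, prove `stub_torsionGaloisRep` and
`stub_serreOccurrence` SIMULTANEOUSLY for induced data without passing through either in general).  The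
normalisation is the one place where a typing slip could falsify a stub: the SIGNED parity
(`−1`-eigenspace the larger one by `m mod 2`) is forced by the centre (`−1 ∈ GL_m(ℚ)` acts trivially on
`H^*(GL_m(ℚ), Fun(GL_m(𝔸_f)/K, k))`, so the central character is even and
`det σ_b(c) = (−1)^{m(m+1)/2}`; e.g. `m = 1`: only even `ψ̃` occur in `H⁰`, `σ_ψ = ψ χ_cyc⁻¹` is odd),
and with it the parity bookkeeping of `stub_oddInduction` reproduces exactly the crux's hypothesis
`Even n ∨ r₁(F) ≤ 1`.

Disproof used: none — `ledger crux ls stmt-Langlands-16942` shows no `Disproof.lean`, the item carries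
no stub-false / line-dead notes, and `ledger negatives --problem Langlands` has no entry on this crux
(2026-08-17; the route's one negative, `Deinduction` = stmt-Langlands-16822, concerns de-induction with
a non-uniform exceptional set and is not an instance of any stub here: every stub keeps ONE finite
exceptional set outside which ALL places are constrained).  BC3 probes (planner folder
`bc/probes.lean`): for each stub, `stub → TorsionLeviInduction` and `stub → Langlands` by
`first | exact? | simpa | simpa [stub] | aesop` FAIL (rc and messages in the planner's NOTES.md).
-/

set_option linter.dupNamespace false

noncomputable section

namespace Summit.Langlands.Langlands.Cruxes.TorsionLeviInduction.Birth

open Summit.Langlands.Langlands.Theses.SplitPrimeInduction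
open scoped NumberField Polynomial
open IsDedekindDomain NumberField Field Polynomial
open Literature.NumberTheory.GaloisRepresentations Literature.NumberTheory.Automorphic

/-! ## 0. Named copies of the crux's clauses (verbatim sub-terms; `crux_iff` below is `Iff.rfl`) -/

section Vocabulary

variable (m : ℕ) (F : Type) [Field F] [NumberField F]

/-- The crux's hypothesis on `p`, verbatim: **`p` is completely split in `F`** — every place `v ∣ p`
has ramification index and residue degree `1` over `ℤ`. [folklore] -/
def IsCompletelySplitIn (p : ℕ) : Prop :=
  ∀ v : HeightOneSpectrum (𝓞 F), ((p : ℕ) : 𝓞 F) ∈ v.asIdeal →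
    v.asIdeal.ramificationIdx ℤ = 1 ∧ v.asIdeal.inertiaDeg ℤ = 1

/-- The crux's clause on `ϖ`, verbatim: **`ϖ_v` is a uniformiser of `F_v` for every finite place `v`**
(valuation `exp(−1)`), so that `heckeDiagAt m F v (ϖ v) j` is Scholze's `diag(ϖ_v^{(j)}, 1^{(m−j)})`.
[folklore] -/
def IsUniformiserFamily (ϖ : ∀ v : HeightOneSpectrum (𝓞 F), (v.adicCompletion F)ˣ) : Prop :=
  ∀ v, Valued.v ((ϖ v : (v.adicCompletion F)ˣ) : v.adicCompletion F) = WithZero.exp (-1 : ℤ)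

/-- The crux's third level clause, verbatim: **`K` contains every `g ∈ GL_m(𝒪̂_F)` whose components
at the places of `S` are `1`** — together with `K` open and `K ≤ GL_m(𝒪̂_F)` this says
`K = K_S · ∏_{v ∉ S} GL_m(𝒪_v)` (Scholze's levels in Cor. V.4.3). [cite: Scholze2015, Cor. V.4.3] -/
def ContainsPrincipalLevelAt (S : Finset (HeightOneSpectrum (𝓞 F)))
    (K : Subgroup (GL (Fin m) (FiniteAdeleRing (𝓞 F) F))) : Prop :=
  ∀ g ∈ glFiniteIntegralLevel m F,
    (∀ v ∈ S, ∀ i j : Fin m,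
      ((g : Matrix (Fin m) (Fin m) (FiniteAdeleRing (𝓞 F) F)) i j) v =
        (1 : Matrix (Fin m) (Fin m) (v.adicCompletion F)) i j) → g ∈ K

end Vocabulary

/-- **The induced Frobenius polynomial at a rational place `v`** built from polynomial data `P` at the
places of `F`: `∏_{w ∣ v} P_w(X^{f(w|v)})` (finite product over the fibre `{w : w ∩ ℤ = v}`, `f(w|v)` the
residue degree).  With `P_w = det(1 − X·σ(Frob_w^{geom}))` this is `det(1 − X·Ind_F^ℚσ(Frob_v^{geom}))`
at a place `v` unramified in `F` (Mackey); it is the right-hand side of the crux's identity, verbatim up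
to the inlining of `scholzeHeckePolynomial`.
[cite: SerreLinearRepresentations1977, §7.2–7.3] -/
def inducedPolynomial {F : Type} [Field F] [NumberField F] {k : Type} [CommRing k]
    (P : HeightOneSpectrum (𝓞 F) → k[X]) (v : HeightOneSpectrum (𝓞 ℚ)) : k[X] :=
  ∏ᶠ w ∈ {w : HeightOneSpectrum (𝓞 F) | w.asIdeal.under (𝓞 ℚ) = v.asIdeal},
    (P w).comp (X ^ w.asIdeal.inertiaDeg (𝓞 ℚ))

/-- The crux, clause by clause (definitional unfolding of §0 and of the tree's `HeckeEigenvaluesOccurGL`,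
`scholzeHeckePolynomial`, whose bodies the route decl inlines since rev 3; certifies that the named
copies are verbatim). [folklore] -/
theorem crux_iff : TorsionLeviInduction ↔
    ∀ (F : Type) [Field F] [NumberField F] (n : ℕ), 1 ≤ n →
      (Even n ∨ InfinitePlace.nrRealPlaces F ≤ 1) →
      ∀ (p : ℕ) [Fact p.Prime], IsCompletelySplitIn F p →
      ∀ (S : Finset (HeightOneSpectrum (𝓞 F))) (K : Subgroup (GL (Fin n) (FiniteAdeleRing (𝓞 F) F)))
        (ϖ : ∀ v : HeightOneSpectrum (𝓞 F), (v.adicCompletion F)ˣ),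
        IsUniformiserFamily F ϖ → IsOpen (K : Set (GL (Fin n) (FiniteAdeleRing (𝓞 F) F))) →
        K ≤ glFiniteIntegralLevel n F → ContainsPrincipalLevelAt n F S K →
      ∀ (k : Type) [Field k] [CharP k p] (i : ℕ) (a : HeightOneSpectrum (𝓞 F) → ℕ → k),
        HeckeEigenvaluesOccurGL n F k S K ϖ i a →
        ∃ (S' : Finset (HeightOneSpectrum (𝓞 ℚ)))
          (K' : Subgroup (GL (Fin (n * Module.finrank ℚ F)) (FiniteAdeleRing (𝓞 ℚ) ℚ)))
          (ϖ' : ∀ v : HeightOneSpectrum (𝓞 ℚ), (v.adicCompletion ℚ)ˣ) (i' : ℕ)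
          (b : HeightOneSpectrum (𝓞 ℚ) → ℕ → k),
          IsUniformiserFamily ℚ ϖ' ∧
          IsOpen (K' : Set (GL (Fin (n * Module.finrank ℚ F)) (FiniteAdeleRing (𝓞 ℚ) ℚ))) ∧
          K' ≤ glFiniteIntegralLevel (n * Module.finrank ℚ F) ℚ ∧
          ContainsPrincipalLevelAt (n * Module.finrank ℚ F) ℚ S' K' ∧
          HeckeEigenvaluesOccurGL (n * Module.finrank ℚ F) ℚ k S' K' ϖ' i' b ∧
          ∀ v : HeightOneSpectrum (𝓞 ℚ), v ∉ S' →
            (∀ w : HeightOneSpectrum (𝓞 F), w.asIdeal.under (𝓞 ℚ) = v.asIdeal → w ∉ S) ∧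
            scholzeHeckePolynomial (n * Module.finrank ℚ F) v.residueCard (b v) =
              inducedPolynomial (fun w => scholzeHeckePolynomial n w.residueCard (a w)) v :=
  Iff.rfl

/-! ## 1. Galois vocabulary in Scholze's normalisation -/

/-- **Scholze's identity at the finite place `w`**: for every prime `𝔓 ∣ w` of `\bar ℤ_F` and every
ARITHMETIC Frobenius `τ` at `𝔓`, `det(1 − X·ρ(τ⁻¹)) = P` (`τ⁻¹` is a geometric Frobenius, Scholze's
`Frob_w`; `Matrix.charpolyRev`).  Literally the conclusion shape of the tree's named fact
`Scholze2015_galoisRep_of_modPEigensystem` (there with `P = scholzeHeckePolynomial n q_w (a w)`).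
[cite: Scholze2015, Cor. V.4.3 and p. 55] -/
def HasScholzePolyAt {F : Type} [Field F] [NumberField F] {A : Type} [CommRing A] [TopologicalSpace A]
    {m : ℕ} (ρ : FramedGaloisRep F A m) (w : HeightOneSpectrum (𝓞 F)) (P : A[X]) : Prop :=
  ∀ 𝔓 ∈ w.primesAbove, ∀ τ : absoluteGaloisGroup F, IsArithFrobAt (𝓞 F) τ 𝔓 →
    ((ρ τ⁻¹ : GL (Fin m) A) : Matrix (Fin m) (Fin m) A).charpolyRev = P

/-- **Scholze-odd involution** (the SIGNED parity of complex conjugation on the Galois representations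
attached, in the normalisation `det(1 − X·Frob^{geom}) = P_v`, to TRIVIAL-coefficient classes of
`GL_m`): either `2 = 0` in `A` (no condition in characteristic `2`), or
`dim ker(M − 1) + (m mod 2) = dim ker(M + 1)` — the `(−1)`-eigenspace is the larger one, by exactly
`m mod 2`.  For `p` odd and `M² = 1` this is Caraiani–Le Hung's `|tr M| ≤ 1` together with the sign
`det M = (−1)^{⌈m/2⌉} = (−1)^{m(m+1)/2}` forced by the centre (the central character of a
trivial-coefficient eigenclass is even: `−1 ∈ GL_m(ℚ)` acts trivially on `H^*(GL_m(ℚ), Fun(GL_m(𝔸_f)/K, k))`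
and so does `(−1)_f` on the surviving part for `p` odd); `m = 1`: `M = −1` (only even `ψ̃` occur in `H⁰`,
`σ_ψ = ψ·χ_cyc⁻¹`); `m = 2`: eigenvalues `{1, −1}`; `m = 3`: `{1, −1, −1}` (e.g.
`σ = Sym²ρ_f ⊗ χ_cyc⁻¹`). [cite: CaraianiLehung2016, Thm. 1.1] -/
def IsScholzeOdd {A : Type} [Field A] {m : ℕ} (M : Matrix (Fin m) (Fin m) A) : Prop :=
  (2 : A) = 0 ∨
    Module.finrank A (Module.End.eigenspace (Matrix.toLin' M) 1) + m % 2 =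
      Module.finrank A (Module.End.eigenspace (Matrix.toLin' M) (-1))

/-- **`ρ` is Scholze-odd at every real place of `F`**: for every real embedding `φ : F →+* ℝ` and every
complex conjugation `c ∈ Γ_F` attached to it (`IsComplexConjugation`, tree), `ρ(c)` is a Scholze-odd
involution.  Vacuous for totally imaginary `F`. [cite: CaraianiLehung2016, Thm. 1.1] -/
def IsOddAtRealPlaces {F : Type} [Field F] {A : Type} [Field A] [TopologicalSpace A] {m : ℕ}
    (ρ : FramedGaloisRep F A m) : Prop :=
  ∀ (φ : F →+* ℝ) (c : absoluteGaloisGroup F), IsComplexConjugation φ c →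
    IsScholzeOdd ((ρ c : GL (Fin m) A) : Matrix (Fin m) (Fin m) A)

/-! ## 2. The three stubs -/

/-- **STUB A — RECIPROCITY mod `p` OVER `F`, WITH SIGNED ODDNESS (Calegari–Geraghty Conjecture A at
trivial weight in Scholze's normalisation; Caraiani–Le Hung parity).**  `F` any number field, `n ≥ 1`,
`p` prime, `K = K_S·∏_{v∉S} GL_n(𝒪_v)` open in `GL_n(𝒪̂_F)`, `ϖ` uniformisers, `k` a field of
characteristic `p`, `a` a system of `T^{(j)}_v`-eigenvalues (`v ∉ S`, `1 ≤ j ≤ n`) OCCURRING in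
`H^i(X_K, k)` (`HeckeEigenvaluesOccurGL`).  Then for every algebraically closed field `k' ⊇ k` (discrete
topology) there is a continuous `σ : Γ_F → GL_n(k')` which is Scholze-odd at every real place of `F` and,
at every `w ∉ S` not above `p`, unramified with `det(1 − X·σ(Frob_w^{geom})) = P_w(a)`
(`scholzeHeckePolynomial`, mapped to `k'`).  Why plausibly true: for `F` totally real or CM it is
Scholze's Cor. V.4.3 (existence, when `S ∪ {w ∣ p}` is stable under `Aut(F/F⁺)` and contains the places
ramified over `F⁺`; for other `S` the theorem is applied with the finite enlargement `S₀` of `S ∪ {w ∣ p}`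
and the finitely many places of `S₀ ∖ (S ∪ {w ∣ p})`, where `K` is still hyperspecial, need the expected
`ℓ ≠ p` local–global compatibility of torsion classes — in print for much of the CM case, not vendored;
conditional on Arthur's transfer outside Rem. V.4.6) plus Caraiani–Le Hung (parity at real places,
totally real `F`, `p > 2`) plus the centre argument for the sign; for general `F` it is Conjecture A of
Calegari–Geraghty (mod `p`, existence + oddness), the statement every "torsion functoriality" programme
presupposes — and, read backwards, the statement this route wants to DERIVE over non-CM `F` from the
crux + Scholze over `ℚ` + de-induction (so a proof of the crux along the route's own mechanism would not
pass through this stub; the skeleton is the mechanism-agnostic Galois detour).  The values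
`a w j` that matter are algebraic over `𝔽_p` (eigenvalues of `𝔽_p`-rational operators on
finite-dimensional cohomology), so one `σ` over `𝔽̄_p ⊆ k'` serves every `k'`.  Why it might fail:
OPEN for `F` neither totally real nor CM — a torsion class over such `F` WITHOUT Galois representation
(¬ Conj. A; the route's own kill criterion for this crux) or one violating the signed parity at a real
place of a mixed-signature `F` (oddness there is conjectural: the route's "n odd, r₁ = 1" caveat) refutes
it; a slip in the sign convention would already show at `n = 1` (only EVEN finite-order Hecke characters
`ψ̃` occur in `H⁰(F^×\𝔸_{F,f}^×/K, k)`, and `σ_ψ = ψ·χ_cyc⁻¹` has `σ_ψ(c_w) = −1` — Scholze-odd as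
defined).  Size: open-problem in general; XL but "in the literature" for totally real / CM `F`.
Leans on: `HeckeEigenvaluesOccurGL`, `scholzeHeckePolynomial` (ScholzeTorsionGalois, fact-free defs),
`FramedGaloisRep`, `IsUnramifiedAt`, `primesAbove`, `IsComplexConjugation` (tree), Mathlib
`IsArithFrobAt`, `Matrix.charpolyRev`, `Module.End.eigenspace`.
[cite: CalegariGeraghty2017, Conj. A] [cite: Scholze2015, Cor. V.4.3, Rem. V.4.6] [cite: CaraianiLehung2016, Thm. 1.1] -/
theorem stub_torsionGaloisRep
    (F : Type) [Field F] [NumberField F] (n : ℕ) (hn : 1 ≤ n) (p : ℕ) [Fact p.Prime]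
    (S : Finset (HeightOneSpectrum (𝓞 F))) (K : Subgroup (GL (Fin n) (FiniteAdeleRing (𝓞 F) F)))
    (ϖ : ∀ v : HeightOneSpectrum (𝓞 F), (v.adicCompletion F)ˣ) (hϖ : IsUniformiserFamily F ϖ)
    (hKo : IsOpen (K : Set (GL (Fin n) (FiniteAdeleRing (𝓞 F) F))))
    (hKi : K ≤ glFiniteIntegralLevel n F) (hKS : ContainsPrincipalLevelAt n F S K)
    (k : Type) [Field k] [CharP k p] (i : ℕ) (a : HeightOneSpectrum (𝓞 F) → ℕ → k)
    (ha : HeckeEigenvaluesOccurGL n F k S K ϖ i a)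
    (k' : Type) [Field k'] [Algebra k k'] [IsAlgClosed k'] [TopologicalSpace k']
    [DiscreteTopology k'] :
    ∃ σ : FramedGaloisRep F k' n,
      IsOddAtRealPlaces σ ∧
      ∀ w : HeightOneSpectrum (𝓞 F), w ∉ S → ((p : ℕ) : 𝓞 F) ∉ w.asIdeal →
        σ.IsUnramifiedAt w ∧
        HasScholzePolyAt σ w ((scholzeHeckePolynomial n w.residueCard (a w)).map (algebraMap k k')) := by
  sorry

/-- **STUB C — INDUCTION OF `k`-RATIONAL FROBENIUS DATA WITH PARITY TRANSFER (provable now).**  Let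
`σ : Γ_F → GL_n(k')` be continuous (any topological field `k' ⊇ k`), Scholze-odd at every real place of
`F`, unramified with `det(1 − X·σ(Frob_w^{geom})) = P_w` (a `k`-rational polynomial, mapped to `k'`) at
every `w ∉ S`, `w ∤ p`.  If `n` is even or `F` has at most one real place, then there are a continuous
`R : Γ_ℚ → GL_{n[F:ℚ]}(k')` — namely `Ind_{Γ_F}^{Γ_ℚ} σ` (tree: `FramedGaloisRep.induce`, reindexed
`d·n ↔ n·d`) — and a finite set `T` of rational places (those below `S`, `p`, and the primes ramified in
`F`) such that `R` is Scholze-odd at the real place of `ℚ` and, for every `v ∉ T`: no place of `S` lies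
over `v`, `R` is unramified at `v`, and `det(1 − X·R(Frob_v^{geom})) = ∏_{w∣v} P_w(X^{f(w|v)})`
(`inducedPolynomial P v`, mapped to `k'`).  Why true: (Frobenius) Mackey's formula for `Res_{D_v} Ind σ`
— double cosets `D_v \ Γ_ℚ / Γ_F` ↔ places `w ∣ v`, `D_v ∩ Γ_F^g = D_w` of index `f(w|v)`, and the
induced module of `A = σ(Frob_w)` from `⟨Frob_v^{f}⟩` to `⟨Frob_v⟩` has `det(1 − X·M^{±1}) =
det(1 − X^f·A^{±1})`; the tree proves the `charpoly` form for `n = 1`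
(`FramedGaloisRep.exists_charpoly_induce_eq_prod`) and unramifiedness in general
(`FramedGaloisRep.isUnramifiedAt_induce`); `Polynomial.map` commutes with `∏ᶠ` and `comp`.  (Parity)
Mackey for `⟨c⟩`: real places `w` of `F` contribute `σ(c_w)` (`c_w = g⁻¹cg ∈ Γ_F` a complex conjugation
for that real embedding), complex places contribute `n` copies of the regular representation of `⟨c⟩`;
hence for `p` odd `dim ker(R(c)+1) − dim ker(R(c)−1) = r₁(F)·(n mod 2)`, which equals
`(n·[F:ℚ]) mod 2 = (n mod 2)(r₁ mod 2)` iff `n` is even or `r₁(F) ≤ 1` — the crux's side condition,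
consumed here and only here; in characteristic `2` there is nothing to show.  Why it might fail: only
through a typing slip (the sign convention of `IsScholzeOdd`, checked above at `m = 1, 2, 3`; the fibre
`{w : w.asIdeal.under (𝓞 ℚ) = v.asIdeal}` is the set of ALL places over `v`, as in the crux).  Size: L
(general-`n` charpoly of the induced Frobenius + the archimedean Mackey computation + `Finset`
bookkeeping for `T`).  Leans on: `FramedGaloisRep.induce`, `isUnramifiedAt_induce`,
`exists_charpoly_induce_eq_prod`, `absGaloisCosetRep` (tree, `InducedGaloisRep` /
`AshSmithTheoryHecke*Proofs`), Mathlib `Matrix.charpolyRev`, `Ideal.inertiaDeg`, `primesOver_finite`.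
[cite: SerreLinearRepresentations1977, §7.2 Prop. 22 and §7.3] [cite: NeukirchANT1999, Ch. I §9] -/
theorem stub_oddInduction
    (F : Type) [Field F] [NumberField F] (n : ℕ) (hn : 1 ≤ n)
    (hpar : Even n ∨ InfinitePlace.nrRealPlaces F ≤ 1)
    (p : ℕ) [Fact p.Prime] (S : Finset (HeightOneSpectrum (𝓞 F)))
    (k : Type) [Field k] (k' : Type) [Field k'] [Algebra k k'] [TopologicalSpace k']
    (σ : FramedGaloisRep F k' n) (hodd : IsOddAtRealPlaces σ)
    (P : HeightOneSpectrum (𝓞 F) → k[X])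
    (hσ : ∀ w : HeightOneSpectrum (𝓞 F), w ∉ S → ((p : ℕ) : 𝓞 F) ∉ w.asIdeal →
      σ.IsUnramifiedAt w ∧ HasScholzePolyAt σ w ((P w).map (algebraMap k k'))) :
    ∃ (R : FramedGaloisRep ℚ k' (n * Module.finrank ℚ F)) (T : Finset (HeightOneSpectrum (𝓞 ℚ))),
      IsOddAtRealPlaces R ∧
      ∀ v : HeightOneSpectrum (𝓞 ℚ), v ∉ T →
        (∀ w : HeightOneSpectrum (𝓞 F), w.asIdeal.under (𝓞 ℚ) = v.asIdeal → w ∉ S) ∧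
        R.IsUnramifiedAt v ∧
        HasScholzePolyAt R v ((inducedPolynomial P v).map (algebraMap k k')) := by
  sorry

/-- **STUB B — SERRE-TYPE OCCURRENCE OVER `ℚ` (generalised Serre conjecture, weak form, in Scholze's
normalisation; the hardest stub).**  `m ≥ 1`, `p` prime, `k` of characteristic `p`, `k' ⊇ k`
algebraically closed with the discrete topology, `R : Γ_ℚ → GL_m(k')` continuous (hence of finite image),
Scholze-odd at the real place, `T` a finite set of rational places off which `R` is unramified with
`k`-RATIONAL `det(1 − X·R(Frob_v^{geom})) = Q_v`.  Then some system `b` of `T^{(j)}_v`-eigenvalues with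
values in `k` OCCURS in `H^{i'}(X_{K'}, k)` for `GL_m/ℚ` at a level `K' = K'_{S'}·∏_{v∉S'} GL_m(ℤ_v)`,
`S' ⊇ T` finite (the prover puts `p ∈ S'`: at `v = p` the polynomial `P_v(b)` collapses to `1` in `k`),
with `P_v(b) = Q_v` for EVERY `v ∉ S'` — i.e. Scholze's `σ_b` is `R` (up to semisimplification).
Why plausibly true: `m = 1` is class field theory (`R = ψ·χ_cyc⁻¹`, `ψ` even of finite order ⇒ `ψ̃`
occurs in `H⁰`; the signed parity excludes exactly the `R` with `R(c) = +1`, which do NOT occur for `p`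
odd); `m = 2` irreducible is Khare–Wintenberger (every Serre weight traded for trivial weight at level
`Γ₁(p^r)` by Ash–Stevens, then `⊗ χ_cyc⁻¹` is a shift of `q`-powers in `T^{(j)}`), `m = 2` reducible odd
is Eisenstein cohomology (`H⁰` of the tower realises `(ψ ⊕ ψχ_cyc⁻¹)⊗χ_cyc⁻¹`; the other odd sums of
two characters need Eisenstein classes in `H¹` at deeper level — expected, only partly in print with
trivial mod-`p` coefficients); `m ≥ 3` is the Ash–Sinnott / Ash–Doud–Pollack conjecture (weak
form: SOME level, trivial coefficients), with its computational evidence (ADP §7.1 includes an INDUCED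
`ρ̄` from the complex cubic field of discriminant `−59`, found mod `7` on `GL₃/ℚ`).  Why it might fail:
OPEN for `m ≥ 3`; for reducible `R` in rank `≥ 3` the needed Eisenstein/boundary eigensystems with
trivial mod-`p` coefficients are not in print; a non-semisimple `R` is harmless (occurrence only sees
`det(1 − X·Frob)`), but an `R` that is Scholze-odd and STILL absent from every `H^{i'}(X_{K'}, k)` — e.g.
by a certified Ash–Gunnells–McConnell census at all levels dividing the Artin bound — refutes it (this
is the route's kill criterion for `MonomialSerreAtSplitPrimes`, the `n = 1` instance of the crux).
Size: open-problem (`m ≥ 3`); XL for `m ≤ 2`.  Leans on: `HeckeEigenvaluesOccurGL`,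
`scholzeHeckePolynomial`, `glFiniteIntegralLevel` (tree), §0–§1 vocabulary.
[cite: AshSinnott2000, Conj. 2.1] [cite: AshDoudPollack2002, Conj. 3.1 and §7.1] [cite: KhareWintenberger2009, Thm. 1.2 (with part II)] [cite: AshStevensCrelle1986, Thm. 1.2 and §1] -/
theorem stub_serreOccurrence
    (m : ℕ) (hm : 1 ≤ m) (p : ℕ) [Fact p.Prime]
    (k : Type) [Field k] [CharP k p]
    (k' : Type) [Field k'] [Algebra k k'] [IsAlgClosed k'] [TopologicalSpace k']
    [DiscreteTopology k']
    (R : FramedGaloisRep ℚ k' m) (hodd : IsOddAtRealPlaces R)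
    (T : Finset (HeightOneSpectrum (𝓞 ℚ))) (Q : HeightOneSpectrum (𝓞 ℚ) → k[X])
    (hR : ∀ v : HeightOneSpectrum (𝓞 ℚ), v ∉ T →
      R.IsUnramifiedAt v ∧ HasScholzePolyAt R v ((Q v).map (algebraMap k k'))) :
    ∃ (S' : Finset (HeightOneSpectrum (𝓞 ℚ)))
      (K' : Subgroup (GL (Fin m) (FiniteAdeleRing (𝓞 ℚ) ℚ)))
      (ϖ' : ∀ v : HeightOneSpectrum (𝓞 ℚ), (v.adicCompletion ℚ)ˣ) (i' : ℕ)
      (b : HeightOneSpectrum (𝓞 ℚ) → ℕ → k),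
      T ⊆ S' ∧ IsUniformiserFamily ℚ ϖ' ∧
      IsOpen (K' : Set (GL (Fin m) (FiniteAdeleRing (𝓞 ℚ) ℚ))) ∧
      K' ≤ glFiniteIntegralLevel m ℚ ∧ ContainsPrincipalLevelAt m ℚ S' K' ∧
      HeckeEigenvaluesOccurGL m ℚ k S' K' ϖ' i' b ∧
      ∀ v : HeightOneSpectrum (𝓞 ℚ), v ∉ S' → scholzeHeckePolynomial m v.residueCard (b v) = Q v := by
  sorry

/-! ## 3. The stub statements as named `Prop`s (literally the types of the stubs; no `sorry` inherited) -/

namespace _Goal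

/-- The statement of `stub_torsionGaloisRep`, as a named `Prop` (literally its type). [folklore] -/
def stub_torsionGaloisRep : Prop :=
  type_of% @Summit.Langlands.Langlands.Cruxes.TorsionLeviInduction.Birth.stub_torsionGaloisRep

/-- The statement of `stub_oddInduction`, as a named `Prop` (literally its type). [folklore] -/
def stub_oddInduction : Prop :=
  type_of% @Summit.Langlands.Langlands.Cruxes.TorsionLeviInduction.Birth.stub_oddInduction

/-- The statement of `stub_serreOccurrence`, as a named `Prop` (literally its type). [folklore] -/
def stub_serreOccurrence : Prop :=
  type_of% @Summit.Langlands.Langlands.Cruxes.TorsionLeviInduction.Birth.stub_serreOccurrence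

end _Goal

/-! ## 4. The composition (kernel-checked, no `sorry`): RECIPROCITY/F → INDUCTION → SERRE/ℚ → crux by name -/

/-- **The crux from the three stubs.**  Given the crux data (`F`, `n`, the parity side condition, a
split `p`, `S`, `K`, `ϖ`, `k`, an occurring `a`): put `k' = \bar k` with the discrete topology; STUB A
gives `σ : Γ_F → GL_n(k')`, Scholze-odd at the real places, unramified with Scholze polynomial `P_w(a)`
off `S ∪ {w ∣ p}`; STUB C induces it to `R : Γ_ℚ → GL_{n[F:ℚ]}(k')`, Scholze-odd (this is where
`Even n ∨ r₁ ≤ 1` is used), unramified with the induced polynomials off a finite `T` whose complement has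
fibres avoiding `S`; STUB B realises `R` as the `σ_b` of an eigensystem `b` occurring in the mod-`p`
cohomology of `GL_{n[F:ℚ]}/ℚ` off some `S' ⊇ T`, which is the crux's conclusion.  Hypotheses are, by
name, the statements of the three stubs; the conclusion is the route decl `TorsionLeviInduction`.  The
split prime is not used (see the module docstring). [folklore] -/
theorem TorsionLeviInduction_of (hA : _Goal.stub_torsionGaloisRep) (hC : _Goal.stub_oddInduction)
    (hB : _Goal.stub_serreOccurrence) : TorsionLeviInduction := by
  unfold _Goal.stub_torsionGaloisRep at hA
  unfold _Goal.stub_oddInduction at hC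
  unfold _Goal.stub_serreOccurrence at hB
  rw [crux_iff]
  intro F _ _ n hn hpar p _ _hsplit S K ϖ hϖ hKo hKi hKS k _ _ i a ha
  -- coefficients: an algebraic closure of `k`, with the discrete topology
  letI : TopologicalSpace (AlgebraicClosure k) := ⊥
  haveI : DiscreteTopology (AlgebraicClosure k) := ⟨rfl⟩
  -- STUB A: the Galois representation over `F` attached to `a`
  obtain ⟨σ, hodd, hσ⟩ := hA F n hn p S K ϖ hϖ hKo hKi hKS k i a ha (AlgebraicClosure k)
  -- STUB C: induce it to `ℚ` (parity transfer uses `hpar`)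
  obtain ⟨R, T, hRodd, hR⟩ := hC F n hn hpar p S k (AlgebraicClosure k) σ hodd
    (fun w => scholzeHeckePolynomial n w.residueCard (a w)) hσ
  -- STUB B: Serre-type occurrence over `ℚ`
  have hm : 1 ≤ n * Module.finrank ℚ F :=
    Nat.one_le_iff_ne_zero.mpr (Nat.mul_ne_zero_iff.mpr ⟨by omega, Module.finrank_pos.ne'⟩)
  obtain ⟨S', K', ϖ', i', b, hTS', hϖ', hK'o, hK'i, hK'S, hb, hPb⟩ :=
    hB (n * Module.finrank ℚ F) hm p k (AlgebraicClosure k) R hRodd T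
      (inducedPolynomial fun w => scholzeHeckePolynomial n w.residueCard (a w))
      (fun v hv => (hR v hv).2)
  exact ⟨S', K', ϖ', i', b, hϖ', hK'o, hK'i, hK'S, hb, fun v hv =>
    ⟨(hR v fun h => hv (hTS' h)).1, hPb v hv⟩⟩

/-- By-name sanity check (an `example`, so it is not a declaration of the file): the three stubs feed
the composition as they stand. -/
example : TorsionLeviInduction :=
  TorsionLeviInduction_of @stub_torsionGaloisRep @stub_oddInduction @stub_serreOccurrence

end Summit.Langlands.Langlands.Cruxes.TorsionLeviInduction.Birth

end
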